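import Summits.ResolutionOfSingularities.ResolutionOfSingularities.Theorems.PurelyInseparableDim4SwapTransportWindowGluePrime
import Summits.ResolutionOfSingularities.ResolutionOfSingularities.Theorems.PurelyInseparableDim4ResConeTwoSlotLegalitySigma
import Summits.ResolutionOfSingularities.ResolutionOfSingularities.Theorems.PurelyInseparableDim4ResConeTwoSlotGameStepSigma
import Summits.ResolutionOfSingularities.ResolutionOfSingularities.Theorems.PurelyInseparableDim4ResConeTwoSlotPinningSigma
import HarnessLib
import HarnessLib.Audit.Tags

/-!
# Purely inseparable four-folds — σ-WINDOW BOOKKEEPING FOR EVERY WEIGHT VECTOR σ = (n, n) + w, w ≥ 1: which chart a σ-keeping step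
# takes, the straight frame read by value, and the straight σ-LEDGER frame surviving a pure slot step (cell `res-dim4-pi`, K2(p) lane,
# B-LF (iii-b) K24a-PRIME-σ, transport layer, FILE T1)

[OURS · counted 0 · cell `res-dim4-pi` · K2(p) lane (holder res-dim4-p-12 g5, ruling g5-17: «K24a-PRIME-σ = step/α res-dim4-p-1 g6 ·
β-readings res-dim4-p-7 g6 · window transport res-dim4-typ-1 g5»).]  Nothing here proves K2(p) for any `p`, any TAIL(p, d, 3),
`NoIsolatedTrap p p` or resolution of singularities in dimension ≥ 4 / characteristic `p` — NOT proved.  AI kernel work, weaker than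
expert review.  Bookkeeping about ONE step of OUR frame; kills nothing by itself.

SETTING (class (i) of the seat's revised map, bus 2026-08-29 12:42Z).  Letters `x, y` (slots, weight `n ≥ 1`), `v` (passive, weight
`w ≥ 1`, `w ≠ n`), `z` (free: the form carrier of the T-normal form, never charted); a σ-state has `r = n·x + n·y + w·v` and order `p + n`
(`n + w + d = p`).  The virtual window of the transport layer shadows the real chain by PURE slot steps of a STRAIGHT σ-LEDGER state.
* §1 `sigma_weights_values` (evaluation of `n·x + n·y + w·v` at the four letters) and **`step_cases_of_weights_sigma`** — if an honest
  `Step p` from a σ-state, in a chart other than the carrier `z`, has a child that is again a σ-state (for SOME three letters), then the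
  chart is a SLOT, no letter other than `z` is translated, and the weights are unchanged letter for letter (`step_r_apply_gen`: the chart
  receives `ord − p = n ≠ w`, a translated letter `0`).
* §2 the straight frame BY VALUE: `resForm_eq_of_readings_sigma` (W3's `resForm_eq_of_readings_prime` with `(d + 2, 2) ↦ (o, o − d)`),
  `readings_of_resForm_sigma` (converse), `initialForm_eq_of_resForm_sigma`.
* §3 **`frame_step_zero_sigma`** — the straight σ-LEDGER frame (`x^r ∣ F`, `resForm = a·x_f^d`, slot ledger `e_f ≤ d − 1 ⇒ e_j, e_i ≥ n + 1`)
  survives a PURE step in the slot `j` given the child's order `p + n` and `e_G = 3`: weights by res-dim4-p-7's `ResCone.step_zero_r_sigma`,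
  `x^r ∣` by `forall_le_step_gen`, straightness and the carried `a` by res-dim4-p-7's `ResCone.twoSlot_legal_readings_of_corner_sigma`
  (i)(ii) — whose Tschirnhaus row `coeff (r + (d−1)·f + 2·j) F = 0` is FREE from the ledger (that exponent has `e_i = n < n + 1`) — and the
  ledger by res-dim4-p-1's `ResCone.ledger_step_zero_sigma` (`hpass` from `x^r ∣`, `h7` from straightness).
* §4 **`pure_step_of_straight_sigma`** — THE PER-STEP TRANSPORT BINDER of the σ-assembly: an honest step from a STRAIGHT σ-state, in a
  chart other than the carrier, whose child is again a σ-state of order `p + n`, IS the pure slot step (`b = 0`): §1 pins every letter but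
  the carrier, σ-(VT-f) (`ResCone.translation_contact_eq_zero_sigma_of_eq`, W2σ p719289) pins the carrier.
[cite: Hauser2010, §§F–G] [cite: HauserPerlega2019PRIMS, §2 (transform D′ of D)] [cite: CossartJannsenSaito2020, Thm. 3.14]
bears_on: LADDER-RESOLUTION:D157-DOOR2 (res-dim4-pi · K2(p) B-LF (iii-b) K24a-PRIME-σ transport layer T1).  Supports
stmt-ResolutionOfSingularities-16155 (helper).
-/

set_option linter.dupNamespace false -- mandated namespace of this single-conjunct summit

noncomputable section

namespace Summit.ResolutionOfSingularities.ResolutionOfSingularities.Theorems.PIDim4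

namespace SwapTransport

open MvPolynomial Finset
open Literature.AlgebraicGeometry.Resolution
open Literature.AlgebraicGeometry.Resolution.CentreBlowup
open Literature.AlgebraicGeometry.Resolution.Hauser2010
open Literature.AlgebraicGeometry.Resolution.HauserPerlega2019

variable {K : Type} [Field K] [DecidableEq K]

/-! ## §1 Which chart a σ-keeping step takes -/

/-- The σ-weights `n·x + n·y + w·v` evaluated at the four letters. [folklore] -/
theorem sigma_weights_values {x y v z : Fin 4} (hxy : x ≠ y) (hxv : x ≠ v) (hxz : x ≠ z) (hyv : y ≠ v) (hyz : y ≠ z)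
    (hvz : v ≠ z) (n w : ℕ) :
    (Finsupp.single x n + Finsupp.single y n + Finsupp.single v w : Fin 4 →₀ ℕ) x = n ∧
      (Finsupp.single x n + Finsupp.single y n + Finsupp.single v w : Fin 4 →₀ ℕ) y = n ∧
      (Finsupp.single x n + Finsupp.single y n + Finsupp.single v w : Fin 4 →₀ ℕ) v = w ∧
      (Finsupp.single x n + Finsupp.single y n + Finsupp.single v w : Fin 4 →₀ ℕ) z = 0 := by
  simp only [Finsupp.add_apply]
  refine ⟨?_, ?_, ?_, ?_⟩
  · rw [Finsupp.single_eq_same, Finsupp.single_eq_of_ne hxy, Finsupp.single_eq_of_ne hxv]; omega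
  · rw [Finsupp.single_eq_of_ne hxy.symm, Finsupp.single_eq_same, Finsupp.single_eq_of_ne hyv]; omega
  · rw [Finsupp.single_eq_of_ne hxv.symm, Finsupp.single_eq_of_ne hyv.symm, Finsupp.single_eq_same]; omega
  · rw [Finsupp.single_eq_of_ne hxz.symm, Finsupp.single_eq_of_ne hyz.symm, Finsupp.single_eq_of_ne hvz.symm]; omega

/-- **WHICH CHART A σ-KEEPING STEP TAKES** (σ = (n, n) + w, `0 < n`, `0 < w`, `w ≠ n`).  `A` has weights `n·x + n·y + w·v` and order
`p + n`; an honest `Step p` in a chart `jr ≠ z` (the carrier is never charted) with translation `b` whose child is again a σ-state for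
SOME three letters is: a SLOT step (`jr = x ∨ jr = y`), translating no letter but `z`, with the weights unchanged letter for letter.
[OURS] [cite: Hauser2010, §F] [cite: HauserPerlega2019PRIMS, §2 (transform D′ of D)] -/
theorem step_cases_of_weights_sigma (p : ℕ) {n w : ℕ} (hn : 0 < n) (hw : 0 < w) (hwn : w ≠ n) {x y v z : Fin 4} (hxy : x ≠ y)
    (hxv : x ≠ v) (hxz : x ≠ z) (hyv : y ≠ v) (hyz : y ≠ z) (hvz : v ≠ z) {A : State K}
    (hrA : A.r = Finsupp.single x n + Finsupp.single y n + Finsupp.single v w) (ho : ordZero A.F = ((p + n : ℕ) : ℕ∞))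
    {jr : Fin 4} (hjz : jr ≠ z) {b : Fin 4 → K} (hbj : b jr = 0)
    (hrA' : ∃ x' y' v' : Fin 4, x' ≠ y' ∧ x' ≠ v' ∧ y' ≠ v' ∧
      (CentreBlowup.step p Finset.univ jr b A).r = Finsupp.single x' n + Finsupp.single y' n + Finsupp.single v' w) :
    (jr = x ∨ jr = y) ∧ (∀ ℓ, ℓ ≠ z → b ℓ = 0) ∧ (CentreBlowup.step p Finset.univ jr b A).r = A.r := by
  obtain ⟨x', y', v', hx'y', hx'v', hy'v', hr'⟩ := hrA'
  obtain ⟨hAx, hAy, hAv, hAz⟩ : A.r x = n ∧ A.r y = n ∧ A.r v = w ∧ A.r z = 0 := by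
    rw [hrA]; exact sigma_weights_values hxy hxv hxz hyv hyz hvz n w
  have hval : ∀ ℓ, (CentreBlowup.step p Finset.univ jr b A).r ℓ = if ℓ = jr then n else if b ℓ = 0 then A.r ℓ else 0 := by
    intro ℓ; rw [step_r_apply_gen p ho jr b ℓ, Nat.add_sub_cancel_left]
  -- values of the child's weights at the primed letters and off them
  have h1 : (CentreBlowup.step p Finset.univ jr b A).r x' = n := by
    rw [hr', Finsupp.add_apply, Finsupp.add_apply, Finsupp.single_eq_same, Finsupp.single_eq_of_ne hx'y',
      Finsupp.single_eq_of_ne hx'v']; omega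
  have h2 : (CentreBlowup.step p Finset.univ jr b A).r y' = n := by
    rw [hr', Finsupp.add_apply, Finsupp.add_apply, Finsupp.single_eq_of_ne hx'y'.symm, Finsupp.single_eq_same,
      Finsupp.single_eq_of_ne hy'v']; omega
  have h3 : (CentreBlowup.step p Finset.univ jr b A).r v' = w := by
    rw [hr', Finsupp.add_apply, Finsupp.add_apply, Finsupp.single_eq_of_ne hx'v'.symm, Finsupp.single_eq_of_ne hy'v'.symm,
      Finsupp.single_eq_same]; omega
  have hz : (CentreBlowup.step p Finset.univ jr b A).r z = 0 := by
    rw [hval, if_neg (fun h => hjz h.symm)]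
    split_ifs
    · exact hAz
    · rfl
  have hjr : (CentreBlowup.step p Finset.univ jr b A).r jr = n := by rw [hval, if_pos rfl]
  -- the passive letter: `v′ = v`, untranslated
  have hv'jr : v' ≠ jr := fun h => hwn (by rw [← h3, h, hjr])
  have hv'z : v' ≠ z := fun h => by rw [h, hz] at h3; omega
  have hv'val : b v' = 0 ∧ A.r v' = w := by
    have h := h3
    rw [hval, if_neg hv'jr] at h
    split_ifs at h with hb
    · exact ⟨hb, h⟩
    · omega
  have hv'v : v' = v := by
    rcases ResCone.letters_exhaust hxy hxv hxz hyv hyz hvz v' with h | h | h | h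
    · exfalso; rw [h, hAx] at hv'val; exact hwn hv'val.2.symm
    · exfalso; rw [h, hAy] at hv'val; exact hwn hv'val.2.symm
    · exact h
    · exact absurd h hv'z
  -- the chart is a slot
  have hjr_xy : jr = x ∨ jr = y := by
    rcases ResCone.letters_exhaust hxy hxv hxz hyv hyz hvz jr with h | h | h | h
    · exact Or.inl h
    · exact Or.inr h
    · exact absurd (hv'v.trans h.symm) hv'jr
    · exact absurd h hjz
  -- both slots keep weight `n`
  have hx'in : x' = x ∨ x' = y := by
    rcases ResCone.letters_exhaust hxy hxv hxz hyv hyz hvz x' with h | h | h | h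
    · exact Or.inl h
    · exact Or.inr h
    · exact absurd (h.trans hv'v.symm) hx'v'
    · exfalso; rw [h, hz] at h1; omega
  have hy'in : y' = x ∨ y' = y := by
    rcases ResCone.letters_exhaust hxy hxv hxz hyv hyz hvz y' with h | h | h | h
    · exact Or.inl h
    · exact Or.inr h
    · exact absurd (h.trans hv'v.symm) hy'v'
    · exfalso; rw [h, hz] at h2; omega
  have hslot : ∀ s, (s = x ∨ s = y) → (CentreBlowup.step p Finset.univ jr b A).r s = n := by
    intro s hs
    rcases hs with hs | hs
    · rcases hx'in with h | h
      · rw [hs, ← h]; exact h1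
      · rcases hy'in with h' | h'
        · rw [hs, ← h']; exact h2
        · exact absurd (h.trans h'.symm) hx'y'
    · rcases hy'in with h' | h'
      · rcases hx'in with h | h
        · exact absurd (h.trans h'.symm) hx'y'
        · rw [hs, ← h]; exact h1
      · rw [hs, ← h']; exact h2
  -- no letter but `z` is translated
  have hb : ∀ ℓ, ℓ ≠ z → b ℓ = 0 := by
    intro ℓ hℓz
    by_cases hℓj : ℓ = jr
    · rw [hℓj]; exact hbj
    rcases ResCone.letters_exhaust hxy hxv hxz hyv hyz hvz ℓ with h | h | h | h
    · have hs := hslot ℓ (Or.inl h)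
      rw [hval, if_neg hℓj] at hs
      split_ifs at hs with hb0
      · exact hb0
      · omega
    · have hs := hslot ℓ (Or.inr h)
      rw [hval, if_neg hℓj] at hs
      split_ifs at hs with hb0
      · exact hb0
      · omega
    · rw [h, ← hv'v]; exact hv'val.1
    · exact absurd h hℓz
  refine ⟨hjr_xy, hb, ?_⟩
  ext ℓ
  rw [hval]
  by_cases hℓj : ℓ = jr
  · rw [if_pos hℓj, hℓj]
    rcases hjr_xy with h | h
    · rw [h, hAx]
    · rw [h, hAy]
  · rw [if_neg hℓj]
    by_cases hℓz : ℓ = z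
    · rw [hℓz, hAz]; split_ifs <;> rfl
    · rw [if_pos (hb ℓ hℓz)]

/-! ## §2 The straight frame, read by value -/

omit [DecidableEq K] in
/-- The residual form from the two readings «`coeff (r + d·e_f) = a`» and «every other degree-`d` residual coefficient vanishes»:
`resForm = a·x_f^d`, every order `o = |r| + d`. [OURS · bookkeeping] -/
theorem resForm_eq_of_readings_sigma {f : Fin 4} {s : State K} {d o : ℕ} (ho : ordZero s.F = ((o : ℕ) : ℕ∞))
    (hrdeg : s.r.degree + d = o) {a : K} (ha : coeff (s.r + Finsupp.single f d) s.F = a)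
    (hstraight : ∀ m : Fin 4 →₀ ℕ, m.degree = d → m ≠ Finsupp.single f d → coeff (s.r + m) s.F = 0) :
    ResCone.resForm s = C a * X f ^ d := by
  classical
  have hhom := ResCone.resForm_isHomogeneous ho
  rw [show o - s.r.degree = d by omega] at hhom
  ext m
  rw [X_pow_eq_monomial, C_mul_monomial, mul_one, coeff_monomial]
  by_cases hm : m.degree = d
  · rw [ResCone.coeff_resForm, NarrowApolarity.coeff_initialForm_of_degree_eq ho (by rw [map_add, hm]; omega)]
    by_cases hmf : Finsupp.single f d = m
    · rw [if_pos hmf, ← hmf, ha]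
    · rw [if_neg hmf, hstraight m hm (Ne.symm hmf)]
  · rw [if_neg (fun h => hm (by rw [← h, Finsupp.degree_single]))]
    by_contra hne
    exact hm (by have := hhom hne; rw [ResCone.weight_one_eq_degree] at this; omega)

omit [DecidableEq K] in
/-- Converse: the two readings from `resForm = a·x_f^d`. [OURS · bookkeeping] -/
theorem readings_of_resForm_sigma {f : Fin 4} {s : State K} {d o : ℕ} (ho : ordZero s.F = ((o : ℕ) : ℕ∞))
    (hrdeg : s.r.degree + d = o) {a : K} (hform : ResCone.resForm s = C a * X f ^ d) :
    coeff (s.r + Finsupp.single f d) s.F = a ∧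
      ∀ m : Fin 4 →₀ ℕ, m.degree = d → m ≠ Finsupp.single f d → coeff (s.r + m) s.F = 0 := by
  classical
  have key : ∀ m : Fin 4 →₀ ℕ, m.degree = d → coeff (s.r + m) s.F = if Finsupp.single f d = m then a else 0 := by
    intro m hm
    rw [← NarrowApolarity.coeff_initialForm_of_degree_eq ho (by rw [map_add, hm]; omega), ← ResCone.coeff_resForm, hform,
      X_pow_eq_monomial, C_mul_monomial, mul_one, coeff_monomial]
  refine ⟨by rw [key _ (Finsupp.degree_single _ _), if_pos rfl], fun m hm hne => by rw [key m hm, if_neg (Ne.symm hne)]⟩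

omit [DecidableEq K] in
/-- The initial form from the frame: `in F = a·x^r·x_f^d`. [OURS · bookkeeping] -/
theorem initialForm_eq_of_resForm_sigma {f : Fin 4} {s : State K} (hdiv : ∀ e ∈ s.F.support, s.r ≤ e) {a : K} {d : ℕ}
    (hform : ResCone.resForm s = C a * X f ^ d) : initialForm s.F = monomial (s.r + Finsupp.single f d) a := by
  rw [← ResCone.monomial_mul_resForm hdiv, hform, X_pow_eq_monomial, C_mul_monomial, mul_one, monomial_mul, one_mul]

/-! ## §3 The straight σ-ledger frame survives a pure slot step -/

/-- **FRAME PROPAGATION, every prime, every σ = (n, n) + w.**  A σ-state `B` (`r = n·j + n·i + w·u`, `x^r ∣ F`, order `p + n`,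
`n + w + d = p`) STRAIGHT at the carrier (`resForm B = a·x_f^d`, `a ≠ 0`) with the SLOT LEDGER (`e_f ≤ d − 1 ⇒ e_j ≥ n + 1 ∧ e_i ≥ n + 1`
on the support) passes all four to its PURE child in the slot `j`, given that the child has order `p + n` and `e_G = 3`: same weights,
`x^r ∣`, `resForm = a·x_f^d` with the SAME `a`, slot ledger.  The `i`-slot edition is this statement with `j ↔ i`. [OURS]
[cite: CossartJannsenSaito2020, Thm. 3.14] [cite: HauserPerlega2019PRIMS, §2 (transform D′ of D)] -/
theorem frame_step_zero_sigma (p : ℕ) [Fact p.Prime] [CharP K p] {n w d : ℕ} (hσ : n + w + d = p) (hn : 1 ≤ n) (hd2 : 2 ≤ d)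
    {j i u f : Fin 4} (hji : j ≠ i) (hju : j ≠ u) (hjf : j ≠ f) (hiu : i ≠ u) (hif : i ≠ f) (huf : u ≠ f) {B : State K}
    (hrB : B.r = Finsupp.single j n + Finsupp.single i n + Finsupp.single u w) (hdivB : ∀ e ∈ B.F.support, B.r ≤ e)
    (hoB : ordZero B.F = ((p + n : ℕ) : ℕ∞)) {a : K} (ha : a ≠ 0) (hformB : ResCone.resForm B = C a * X f ^ d)
    (hledB : ∀ e ∈ B.F.support, e f ≤ d - 1 → n + 1 ≤ e j ∧ n + 1 ≤ e i)
    (hoB' : ordZero (CentreBlowup.step p Finset.univ j 0 B).F = ((p + n : ℕ) : ℕ∞))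
    (he3B' : Module.finrank K (ResCone.resVertex (CentreBlowup.step p Finset.univ j 0 B)) = 3) :
    (CentreBlowup.step p Finset.univ j 0 B).r = B.r ∧
      (∀ e ∈ (CentreBlowup.step p Finset.univ j 0 B).F.support, (CentreBlowup.step p Finset.univ j 0 B).r ≤ e) ∧
      ResCone.resForm (CentreBlowup.step p Finset.univ j 0 B) = C a * X f ^ d ∧
      (∀ e ∈ (CentreBlowup.step p Finset.univ j 0 B).F.support, e f ≤ d - 1 → n + 1 ≤ e j ∧ n + 1 ≤ e i) := by
  obtain ⟨hBj, hBi, hBu, hBf⟩ : B.r j = n ∧ B.r i = n ∧ B.r u = w ∧ B.r f = 0 := by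
    rw [hrB]; exact sigma_weights_values hji hju hjf hiu hif huf n w
  have hrdeg : B.r.degree + d = p + n := by
    rw [hrB, map_add, map_add, Finsupp.degree_single, Finsupp.degree_single, Finsupp.degree_single]; omega
  have hr' : (CentreBlowup.step p Finset.univ j 0 B).r = B.r := ResCone.step_zero_r_sigma p hoB hBj
  have hdiv' := forall_le_step_gen (q := p) B hdivB j (b := (0 : Fin 4 → K)) rfl
  obtain ⟨haB, hstraightB⟩ := readings_of_resForm_sigma hoB hrdeg hformB
  -- the Tschirnhaus row is free from the ledger
  have htsch : coeff (B.r + (Finsupp.single f (d - 1) + Finsupp.single j 2)) B.F = 0 := by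
    by_contra hne
    have h := hledB _ (MvPolynomial.mem_support_iff.mpr hne) (by
      rw [Finsupp.add_apply, Finsupp.add_apply, hBf, Finsupp.single_eq_same, Finsupp.single_eq_of_ne hjf.symm]; omega)
    have h2 := h.2
    rw [Finsupp.add_apply, Finsupp.add_apply, hBi, Finsupp.single_eq_of_ne hif, Finsupp.single_eq_of_ne hji.symm] at h2
    omega
  obtain ⟨hstraight', hcarry, -⟩ := ResCone.twoSlot_legal_readings_of_corner_sigma p hσ hn hd2 hji hju hjf hiu hif huf hrB hdivB
    hoB (by rw [haB]; exact ha) hstraightB htsch hoB' he3B'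
  have hform' : ResCone.resForm (CentreBlowup.step p Finset.univ j 0 B) = C a * X f ^ d := by
    refine resForm_eq_of_readings_sigma hoB' (by rw [hr']; exact hrdeg) ?_ ?_
    · rw [hr', hcarry, haB]
    · intro m hm hne; rw [hr']; exact hstraight' m hm hne
  -- the ledger
  have hpass : ∀ e ∈ B.F.support, w ≤ e u := fun e he => by have h := hdivB e he u; rwa [hBu] at h
  have h7 : ∀ e ∈ B.F.support, e f ≤ d - 1 → p + n + 1 ≤ e.degree := by
    intro e he hef
    by_contra hlt
    have hcoef := MvPolynomial.mem_support_iff.mp he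
    rcases Nat.lt_or_ge e.degree (p + n) with h | h
    · exact hcoef (coeff_eq_zero_of_degree_lt_ordZero (by rw [hoB]; exact_mod_cast h))
    · have heq : e.degree = p + n := by omega
      obtain ⟨m, rfl⟩ : ∃ m, e = B.r + m := ⟨e - B.r, (add_tsub_cancel_of_le (hdivB e he)).symm⟩
      have hm : m.degree = d := by rw [map_add] at heq; omega
      have hne : m ≠ Finsupp.single f d := by
        intro hm'; rw [hm', Finsupp.add_apply, hBf, Finsupp.single_eq_same] at hef; omega
      exact hcoef (hstraightB m hm hne)
  have hled' := ResCone.ledger_step_zero_sigma hji hju hjf hiu hif huf p hσ B hpass h7 hledB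
  exact ⟨hr', hdiv', hform', hled'⟩

/-! ## §4 The per-step transport binder: an honest σ-keeping step from a straight σ-state is the pure slot step -/

/-- **PURE STEP EXTRACTION, every prime, every σ = (n, n) + w (w ≥ 1, w ≠ n).**  An honest `Step p` from a STRAIGHT σ-state `A`
(`r = n·x + n·y + w·v`, `x^r ∣ F`, order `p + n`, `resForm A = a·x_z^d`, `a ≠ 0`, `n + w + d = p`) in a chart `jr ≠ z`, whose child is
again a σ-state (for some three letters) of order `p + n`, has translation `b = 0`: it is the PURE step in the slot `jr ∈ {x, y}` and keeps
the weights letter for letter.  (§1 pins every letter but the carrier `z`; σ-(VT-f) pins `z`.) [OURS]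
[cite: CossartJannsenSaito2020, Thm. 3.14] [cite: Hauser2010, §§F, I] -/
theorem pure_step_of_straight_sigma (p : ℕ) {n w d : ℕ} (hσ : n + w + d = p) (hn : 0 < n) (hw : 0 < w) (hwn : w ≠ n)
    (hd1 : 1 ≤ d) {x y v z : Fin 4} (hxy : x ≠ y) (hxv : x ≠ v) (hxz : x ≠ z) (hyv : y ≠ v) (hyz : y ≠ z) (hvz : v ≠ z)
    {A : State K} (hrA : A.r = Finsupp.single x n + Finsupp.single y n + Finsupp.single v w)
    (hdivA : ∀ e ∈ A.F.support, A.r ≤ e) (ho : ordZero A.F = ((p + n : ℕ) : ℕ∞)) {a : K} (ha : a ≠ 0)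
    (hformA : ResCone.resForm A = C a * X z ^ d) {jr : Fin 4} (hjz : jr ≠ z) {b : Fin 4 → K} (hbj : b jr = 0)
    (hrA' : ∃ x' y' v' : Fin 4, x' ≠ y' ∧ x' ≠ v' ∧ y' ≠ v' ∧
      (CentreBlowup.step p Finset.univ jr b A).r = Finsupp.single x' n + Finsupp.single y' n + Finsupp.single v' w)
    (ho' : ordZero (CentreBlowup.step p Finset.univ jr b A).F = ((p + n : ℕ) : ℕ∞)) :
    b = 0 ∧ (jr = x ∨ jr = y) ∧ (CentreBlowup.step p Finset.univ jr b A).r = A.r := by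
  obtain ⟨hslot, hbz, hr'⟩ := step_cases_of_weights_sigma p hn hw hwn hxy hxv hxz hyv hyz hvz hrA ho hjz hbj hrA'
  obtain ⟨hAx, hAy, -, hAz⟩ : A.r x = n ∧ A.r y = n ∧ A.r v = w ∧ A.r z = 0 := by
    rw [hrA]; exact sigma_weights_values hxy hxv hxz hyv hyz hvz n w
  have hrdeg : A.r.degree + d = p + n := by
    rw [hrA, map_add, map_add, Finsupp.degree_single, Finsupp.degree_single, Finsupp.degree_single]; omega
  have hrjr : A.r jr = n := by
    rcases hslot with h | h
    · rw [h, hAx]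
    · rw [h, hAy]
  have hin : initialForm A.F = monomial (A.r + Finsupp.single z d) a := initialForm_eq_of_resForm_sigma hdivA hformA
  have hbzero : b z = 0 :=
    ResCone.translation_contact_eq_zero_sigma_of_eq p hd1 hn (by omega) hjz hAz hrjr hrdeg ho ha hin hbz ho'
  refine ⟨funext fun ℓ => ?_, hslot, hr'⟩
  show b ℓ = 0
  by_cases h : ℓ = z
  · rw [h, hbzero]
  · exact hbz ℓ h

end SwapTransport

end Summit.ResolutionOfSingularities.ResolutionOfSingularities.Theorems.PIDim4

end
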